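import Literature.Computability.Complexity.Promise
import Literature.Computability.Complexity.OracleProofs
import Literature.Computability.Complexity.ReductionsProofs
import Literature.Computability.Complexity.PairProjections
import Literature.Computability.Cryptography.OracleGames
import HarnessLib

/-!
# Program (instance) checking and function-restricted interactive proofs (Blum–Kannan)

Topic `Computability/Complexity`, namespace `Literature.Computability.Complexity`.

Blum–Kannan's *program checker* (also "instance checker"): a probabilistic polynomial-time
oracle machine `C` which, given as oracle a program `P` claiming to solve a decision problem `π`
and an instance `x`, says CORRECT with high probability whenever `P` is bug-free, and BUGGY with
high probability whenever `P(x) ≠ π(x)` [Blum–Kannan 1995, §2, p. 271; Arora–Barak 2009,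
Def. 8.26; Fortnow–Rompel–Sipser 1994, §3, p. 550]; and the characterisation of the checkable
problems by *function-restricted interactive proofs* — proof systems whose verifier is a
probabilistic polynomial-time ORACLE machine (the prover commits to a function: FRS94's
"probabilistic oracle machines", equivalent to multi-prover interactive proofs, FRS94 Thm. 3.1)
and whose HONEST oracle merely decides `π` [BK95 §7, p. 288; FRS94 §3, p. 550]: "`π` has an
efficient program checker iff `π ∈` function-restricted IP `∩` co-function-restricted IP"
[BK95 Thm. 7.1] — "a language `L` has an instance checker if both `L` and `L̄` have
function-restricted interactive proof systems" [FRS94, p. 550].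

## Contents

* `ProbOracleMachine` — FRS94's probabilistic polynomial-time oracle machine; this IS the tree's
  `Literature.Computability.Cryptography.OracleAdversary Bool` (an `OracleAlg Bool` run on the
  coin-extended input `⟨x, r⟩`, `r ∈ {0,1}^{coins |x|}`, for `fuel |x|` rounds; PPT = `IsPPT`);
  `OracleAdversary.acceptProbOn M O x`, its acceptance probability on an ARBITRARY input `x` in the
  counting form `uniformProb` of `bp`/`BPPRel`/`IPVerifier.acceptProb` (`OracleGames.lean` names
  only the unary-input case `acceptProb`), and the bridge `acceptProbOn_eq_toReal_outputPMF`.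
* Programs and decision problems. BK's decision problem `π` has a set of instances split into
  YES- and NO-instances — in the tree a `PromiseProblem` `Q` (instances `Q.yes ∪ Q.no`); a
  (deterministic, everywhere halting) program, like every prover of a function-restricted proof
  system, "must be a function from the set of instances to {YES, NO}" [BK95 §7] — in the tree a
  language `A` (the strings the program accepts), plugged in as the one-bit oracle
  `Oracle.ofLanguage A`. `Q.IsDecidedBy A` ("`P` has no bugs"), `Q.ErrsAt A x` ("`P(x) ≠ π(x)`").
* `IsInstanceChecker C Q`, `PromiseProblem.InstanceCheckable Q`, and the language case
  `InstanceCheckable L := (ofLanguage L).InstanceCheckable` (AB Def. 8.26, `T = χ_L`; FRS94).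
* `FrProves M Q` (completeness `2/3` with EVERY honest oracle, i.e. every `A` deciding `Q`;
  soundness `1/3` against EVERY oracle), the class `PromiseFrIP`, and the language class
  `frIP := {L | ofLanguage L ∈ PromiseFrIP}` (FRS94 §3).
* The named fact `instanceCheckable_iff` (BK95 Thm. 7.1), its language form
  `instanceCheckable_iff.language : InstanceCheckable L ↔ L ∈ frIP ∧ Lᶜ ∈ frIP` (proved from it),
  unfolding lemmas, and the non-vacuity theorem `P_subset_frIP : P ⊆ frIP`.

## Design notes (what is, and is not, the printed wording)

* Thresholds. BK state (1)/(2) with a unary security parameter `k` and error `2^{-k}` (for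
  "probabilistic expected-poly-time" checkers); FRS94 use error `2^{-n}`; AB Def. 8.26 has
  `≥ 2/3` / `< 1/3`. As everywhere in the tree (`bp`, `IPVerifier.Proves`, `PromiseBPP'`) we take
  `2/3` and `1/3` (non-strict); the printed bounds follow by `O(k)` independent repetitions and a
  majority vote, a program / an oracle being a FIXED function (FRS94 §2: "we could reduce a
  constant error … by running the protocols several times serially") — not asserted here.
* Verdicts. CORRECT = the checker halts with output `true` within `fuel |x|` rounds (the event of
  `acceptProbOn`); everything else (output `false`, no output in time) is BUGGY. So BK's clause
  (2) "BUGGY with probability `≥ 2/3`" is literally `acceptProbOn ≤ 1/3`, AB's form.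
* Polynomial time is `OracleAdversary.IsPPT encodingBoolBool` (step function polynomial-time in
  (input, answers so far); polynomial coin and round budgets); the round budget is the machine's
  clock, so no halting hypothesis "for every oracle" is needed. All oracles here are ONE-BIT
  oracles `Oracle.ofLanguage A`, for which this is the textbook model: a transcript of `fuel |x|`
  rounds has length `O(fuel |x|)`, so every step, and every query it writes, is polynomially
  bounded in `|x|` (adequacy note of `Oracle.lean`; `PRel`'s explicit query-length clause only
  matters for oracles with long answers).
* BK additionally require the "little oh property" (checker time `o(`time of the program
  checked`)`, p. 272), which refers to a particular program's running time and is dropped by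
  AB Def. 8.26 and FRS94; it is NOT part of `IsInstanceChecker` (so every `L ∈ P` is trivially
  checkable here, as in AB).
* "The verifier may only ask questions that are instances of `π`" [BK95 §7] is rendered
  semantically: completeness must hold for EVERY oracle `A` deciding `Q` (arbitrary off the
  promise), so off-promise answers of an honest prover carry no information. For a language
  (`ofLanguage L`) the honest oracle is exactly `Oracle.ofLanguage L` (`isDecidedBy_ofLanguage_iff`),
  FRS94's "`M^L` accepts".
* BK's *co-function-restricted IP* (a proof system for the NO-instances whose honest prover
  computes `π`) is, after negating every oracle answer — a syntactic polynomial-time change of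
  the verifier — a function-restricted proof system for `Q.swap` (`isDecidedBy_swap_iff`); we state
  Thm. 7.1 with `Q.swap ∈ PromiseFrIP`, which for languages is literally FRS94's "`L` and `L̄` have
  function-restricted interactive proof systems" (`PromiseProblem.swap_ofLanguage`).
* For `SAT`: the CNF decision problem is the tree's `satUnsatPromise = ⟨SAT, UNSAT⟩`
  (`GapSetCover.lean`), whose `swap` side is "UNSAT has a function-restricted proof system"; the
  language forms `InstanceCheckable SAT`, `UNSAT ∈ frIP` differ from the promise forms only by the
  polynomial-time codeword test (not carried out here).
* Not here: the proof of Thm. 7.1 (two oracle-machine compositions); `SAT ∈ frIP` /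
  self-reducibility and BK95 Cor. 7.2 (NP-SEARCH problems); `MIP` (`= NEXP`; FRS94 Thm. 3.1,
  Cor. 3.2, Thm. 4.1); the checkers for graph isomorphism, `#SAT_D`, permanent (AB §8.6). Mathlib
  has no program checking, oracle proof systems or `MIP` (searched `checker`, `MIP`,
  `multiprover`, `instance check`).

## References

* M. Blum, S. Kannan, *Designing programs that check their work*, J. ACM 42 (1995) 269–291
  (STOC 1989), §2 (program checkers, p. 271; remarks, little-oh property, p. 272), §7
  (function-restricted IP, Thm. 7.1, Cor. 7.2, pp. 288–289).
* L. Fortnow, J. Rompel, M. Sipser, *On the power of multi-prover interactive protocols*,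
  Theoret. Comput. Sci. 134 (1994) 545–557, §3 (probabilistic oracle machines, p. 548; Thm. 3.1;
  function-restricted IP and instance checkers, Cor. 3.2, p. 550).
* S. Arora, B. Barak, *Computational Complexity: A Modern Approach*, CUP 2009, §8.6 (Def. 8.26,
  program checkers; §8.6.1, Thms. 8.29–8.30).
-/

namespace Literature.Computability.Complexity

open _root_.Computability
open Literature.Computability.Cryptography (OracleAdversary)

/-! ### Probabilistic polynomial-time oracle machines on arbitrary inputs -/

/-- A **probabilistic (polynomial-time) oracle machine** in the sense of Fortnow–Rompel–Sipser:
a deterministic transcript-style oracle algorithm `alg : OracleAlg Bool` run on the coin-extended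
input `⟨x, r⟩ = boolPair x r` with `r` uniform in `{0,1}^{coins |x|}` for `fuel |x|` rounds. This is
the tree's `Literature.Computability.Cryptography.OracleAdversary Bool` (Goldreich's PPT oracle
machines), named here after its rôle as the VERIFIER of oracle proof systems and as a program
CHECKER; polynomial time is `OracleAdversary.IsPPT encodingBoolBool`.
[cite: FortnowRompelSipser1994, §3 (p. 548)] -/
abbrev ProbOracleMachine : Type :=
  OracleAdversary Bool

/-- **Acceptance probability on an arbitrary input**: `M.acceptProbOn O x = Pr_r[M^O(x; r) = 1]`,
the probability over `r ∈ {0,1}^{coins |x|}` that `M.alg`, run with oracle `O` on `boolPair x r` for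
`fuel |x|` rounds, halts with output `true` (counting form `uniformProb`, as in `bp` / `BPPRel` /
`IPVerifier.acceptProb`; a run with output `false` or without output in time does not accept).
Deliberate dot-notation extension of `Literature.Computability.Cryptography.OracleAdversary`, whose
`acceptProb` is the special case of the unary inputs `1ⁿ` (`acceptProb_eq_acceptProbOn`).
[cite: FortnowRompelSipser1994, §3 (p. 548, "M^O accepts x with probability")] -/
noncomputable def _root_.Literature.Computability.Cryptography.OracleAdversary.acceptProbOn
    (M : OracleAdversary Bool) (O : Oracle) (x : List Bool) : ℝ :=
  uniformProb (M.coins.eval x.length)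
    {r | M.alg.run O (M.fuel.eval x.length) (boolPair x r) = some true}

end Literature.Computability.Complexity

namespace Literature.Computability.Cryptography.OracleAdversary

open _root_.Computability Literature.Computability.Complexity

variable (M : OracleAdversary Bool) (O : Oracle)

/-- Unfolding lemma for `acceptProbOn`. [folklore] -/
theorem acceptProbOn_eq (x : List Bool) :
    M.acceptProbOn O x = uniformProb (M.coins.eval x.length)
      {r | M.alg.run O (M.fuel.eval x.length) (boolPair x r) = some true} :=
  rfl

/-- Acceptance probabilities are nonnegative. [folklore] -/
theorem acceptProbOn_nonneg (x : List Bool) : 0 ≤ M.acceptProbOn O x :=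
  uniformProb_nonneg _ _

/-- Acceptance probabilities are at most `1`. [folklore] -/
theorem acceptProbOn_le_one (x : List Bool) : M.acceptProbOn O x ≤ 1 :=
  uniformProb_le_one _ _

/-- **Bridge to the output law**: `acceptProbOn` is the mass of `some true` under
`OracleAdversary.outputPMF` (the push-forward of the uniform coins under the deterministic run).
[cite: AroraBarakCC2009, Def. 7.1 (probabilistic machines as deterministic machines reading coins)] -/
theorem acceptProbOn_eq_toReal_outputPMF (x : List Bool) :
    M.acceptProbOn O x = (M.outputPMF O x (some true)).toReal := by
  rw [acceptProbOn_eq, uniformProb_eq_toOuterMeasure, ← PMF.toOuterMeasure_apply_singleton,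
    outputPMF_eq_map, PMF.toOuterMeasure_map_apply]
  rfl

/-- The unary-input acceptance probability of `OracleGames.lean` is `acceptProbOn` at `1ⁿ`.
[folklore] -/
theorem acceptProb_eq_acceptProbOn (n : ℕ) :
    M.acceptProb O n = M.acceptProbOn O (unaryEncodeNat n) := by
  rw [acceptProb, acceptProbOn_eq_toReal_outputPMF]

end Literature.Computability.Cryptography.OracleAdversary

namespace Literature.Computability.Complexity

open _root_.Computability
open Literature.Computability.Cryptography (OracleAdversary)

/-! ### Programs for a decision problem: bug-free programs and bugs -/

namespace PromiseProblem

/-- **`A` decides `Q`** ("the program `P` has no bugs", Blum–Kannan §2: `P(x) = π(x)` for every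
instance `x` of `π`): the program accepting exactly the strings of `A` answers YES on every
YES-instance and NO on every NO-instance of `Q`; nothing is required off the promise
`Q.yes ∪ Q.no`. (The separating languages of `promiseLift`.) [cite: BlumKannan1995, §2 (p. 271)] -/
def IsDecidedBy (Q : PromiseProblem) (A : Language Bool) : Prop :=
  (∀ x ∈ Q.yes, x ∈ A) ∧ ∀ x ∈ Q.no, x ∉ A

/-- **`A` errs at `x`** ("`P(x) ≠ π(x)`" for the instance `x`, Blum–Kannan §2): `x` is a
YES-instance rejected by the program, or a NO-instance accepted by it.
[cite: BlumKannan1995, §2 (p. 271)] -/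
def ErrsAt (Q : PromiseProblem) (A : Language Bool) (x : List Bool) : Prop :=
  (x ∈ Q.yes ∧ x ∉ A) ∨ (x ∈ Q.no ∧ x ∈ A)

variable {Q : PromiseProblem} {A : Language Bool} {x : List Bool}

/-- A program is bug-free iff it errs at no instance. [cite: BlumKannan1995, §2 (p. 271)] -/
theorem isDecidedBy_iff_forall_not_errsAt : Q.IsDecidedBy A ↔ ∀ x, ¬ Q.ErrsAt A x := by
  simp only [IsDecidedBy, ErrsAt, not_or, not_and, not_not]
  exact ⟨fun h x => ⟨h.1 x, fun hx hA => h.2 x hx hA⟩, fun h => ⟨fun x => (h x).1, fun x => (h x).2⟩⟩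

/-- An error occurs at an instance. [folklore] -/
theorem ErrsAt.mem_or_mem (h : Q.ErrsAt A x) : x ∈ Q.yes ∨ x ∈ Q.no :=
  h.imp And.left And.left

/-- A bug-free program does not err. [folklore] -/
theorem IsDecidedBy.not_errsAt (h : Q.IsDecidedBy A) (x : List Bool) : ¬ Q.ErrsAt A x :=
  isDecidedBy_iff_forall_not_errsAt.1 h x

/-- A problem with a bug-free program is disjoint (an instance on both sides would have to be
accepted and rejected by it). [folklore] -/
theorem IsDecidedBy.not_mem_no (h : Q.IsDecidedBy A) (hx : x ∈ Q.yes) : x ∉ Q.no :=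
  fun hno => h.2 x hno (h.1 x hx)

/-- For a language (trivial promise) the only bug-free program is the language itself.
[cite: FortnowRompelSipser1994, §3 (p. 550, "the honest oracle must just compute the language")] -/
theorem isDecidedBy_ofLanguage_iff {L : Language Bool} : (ofLanguage L).IsDecidedBy A ↔ A = L := by
  simp only [IsDecidedBy, yes_ofLanguage, no_ofLanguage]
  constructor
  · rintro ⟨h₁, h₂⟩
    ext x
    exact ⟨fun hx => by_contra fun hL => h₂ x hL hx, h₁ x⟩
  · rintro rfl
    exact ⟨fun _ h => h, fun _ h => h⟩

/-- For a language, the program errs at `x` iff its answer at `x` is wrong. [folklore] -/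
theorem errsAt_ofLanguage_iff {L : Language Bool} :
    (ofLanguage L).ErrsAt A x ↔ ¬ (x ∈ A ↔ x ∈ L) := by
  simp only [ErrsAt, yes_ofLanguage, no_ofLanguage]
  change (x ∈ L ∧ x ∉ A) ∨ (x ∉ L ∧ x ∈ A) ↔ _
  tauto

/-- Deciding the swapped problem is deciding the problem with the complementary program.
[cite: BlumKannan1995, §7 (p. 288, co-function-restricted IP)] -/
theorem isDecidedBy_swap_iff : Q.swap.IsDecidedBy A ↔ Q.IsDecidedBy Aᶜ := by
  simp only [IsDecidedBy, yes_swap, no_swap]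
  change ((∀ x ∈ Q.no, x ∈ A) ∧ ∀ x ∈ Q.yes, x ∉ A) ↔ (∀ x ∈ Q.yes, x ∉ A) ∧ ∀ x ∈ Q.no, ¬ x ∉ A
  simp only [not_not]
  exact And.comm

/-- Errors of a program for the swapped problem are the errors of the complementary program.
[folklore] -/
theorem errsAt_swap_iff : Q.swap.ErrsAt A x ↔ Q.ErrsAt Aᶜ x := by
  simp only [ErrsAt, yes_swap, no_swap]
  change (x ∈ Q.no ∧ x ∉ A) ∨ (x ∈ Q.yes ∧ x ∈ A) ↔ (x ∈ Q.yes ∧ ¬ x ∉ A) ∨ (x ∈ Q.no ∧ x ∉ A)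
  rw [not_not]
  exact Or.comm

end PromiseProblem

/-! ### Program checkers (Blum–Kannan; Arora–Barak Def. 8.26) -/

/-- **`C` is a program (instance) checker for the decision problem `Q`** (Blum–Kannan §2 with
Arora–Barak's constants, module docstring): for every program — a language `A`, given to `C` as
the one-bit oracle `Oracle.ofLanguage A` — and every instance `x`,
(1) if `A` decides `Q` (no bugs) then `C^A(x)` says CORRECT (halts with `true` in time) with
probability `≥ 2/3`; (2) if `A` errs at `x` then `C^A(x)` says CORRECT with probability `≤ 1/3`,
i.e. BUGGY with probability `≥ 2/3`. Nothing is required when `A` is buggy elsewhere but right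
at `x` (AB: "the output of the checker is allowed to be arbitrary").
[cite: BlumKannan1995, §2 (p. 271)] [cite: AroraBarakCC2009, Def. 8.26]
[cite: FortnowRompelSipser1994, §3 (p. 550)] -/
def IsInstanceChecker (C : ProbOracleMachine) (Q : PromiseProblem) : Prop :=
  ∀ (A : Language Bool) (x : List Bool),
    (Q.IsDecidedBy A → (x ∈ Q.yes ∨ x ∈ Q.no) →
      (2 / 3 : ℝ) ≤ C.acceptProbOn (Oracle.ofLanguage A) x) ∧
    (Q.ErrsAt A x → C.acceptProbOn (Oracle.ofLanguage A) x ≤ 1 / 3)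

/-- **The decision problem `Q` is checkable** ("an efficient program checker `C_π` exists"):
some probabilistic POLYNOMIAL-TIME oracle machine is a program checker for `Q`.
[cite: BlumKannan1995, §2 (p. 271) and §7 (p. 288)] [cite: AroraBarakCC2009, Def. 8.26] -/
def PromiseProblem.InstanceCheckable (Q : PromiseProblem) : Prop :=
  ∃ C : ProbOracleMachine, C.IsPPT encodingBoolBool ∧ IsInstanceChecker C Q

/-- **The language `L` has an instance checker** (Arora–Barak Def. 8.26 for the task `T = χ_L`;
FRS94: "an instance checker for a language `L`"): the trivial-promise case `ofLanguage L`, where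
every string is an instance and the only bug-free program is `L` itself.
[cite: AroraBarakCC2009, Def. 8.26] [cite: FortnowRompelSipser1994, §3 (p. 550)] -/
def InstanceCheckable (L : Language Bool) : Prop :=
  (PromiseProblem.ofLanguage L).InstanceCheckable

/-! ### Function-restricted interactive proofs (Blum–Kannan §7; FRS94 §3) -/

/-- **`M` is a function-restricted proof system for `Q`**: the probabilistic oracle machine `M`
(the verifier; the prover is an oracle, i.e. commits to a function — FRS94's probabilistic
oracle machines) satisfies COMPLETENESS with every honest oracle — every program `A` that
decides `Q` makes `M` accept each YES-instance with probability `≥ 2/3` ("the honest oracle must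
just compute the language") — and SOUNDNESS against every oracle — on a NO-instance no `A`
makes `M` accept with probability `> 1/3` ("the dishonest oracle may still compute any
function"). [cite: BlumKannan1995, §7 (p. 288)] [cite: FortnowRompelSipser1994, §3 (pp. 548, 550)] -/
def FrProves (M : ProbOracleMachine) (Q : PromiseProblem) : Prop :=
  (∀ A : Language Bool, Q.IsDecidedBy A →
      ∀ x ∈ Q.yes, (2 / 3 : ℝ) ≤ M.acceptProbOn (Oracle.ofLanguage A) x) ∧
    ∀ (A : Language Bool), ∀ x ∈ Q.no, M.acceptProbOn (Oracle.ofLanguage A) x ≤ 1 / 3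

/-- **Function-restricted IP for decision problems** (Blum–Kannan's "function-restricted IP",
over problems with a set of instances): the decision problems having a POLYNOMIAL-TIME
function-restricted proof system. Blum–Kannan's "co-function-restricted IP" is membership of
`Q.swap` (module docstring). [cite: BlumKannan1995, §7 (p. 288)]
[cite: FortnowRompelSipser1994, §3 (p. 550)] -/
def PromiseFrIP : Set PromiseProblem :=
  {Q | ∃ M : ProbOracleMachine, M.IsPPT encodingBoolBool ∧ FrProves M Q}

/-- **`frIP`, function-restricted IP** (FRS94 §3 after Blum–Kannan): the languages `L` accepted by
a probabilistic polynomial-time oracle machine `M` with (1) `x ∈ L ⇒ M^L` accepts `x` with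
probability `≥ 2/3` (honest oracle = `L` itself) and (2) `x ∉ L ⇒` for ALL oracles `A`, `M^A`
accepts `x` with probability `≤ 1/3`; i.e. `ofLanguage L ∈ PromiseFrIP`. By FRS94 Cor. 3.2 these
are the languages with a multi-prover interactive proof whose honest provers only answer
membership queries about `L`. [cite: FortnowRompelSipser1994, §3 (p. 550) and Cor. 3.2]
[cite: BlumKannan1995, §7 (p. 288)] -/
def frIP : Set (Language Bool) :=
  {L | PromiseProblem.ofLanguage L ∈ PromiseFrIP}

/-! ### Blum–Kannan's characterisation of the checkable problems (named fact, D-0014) -/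

/-- **Blum–Kannan 1995, Theorem 7.1: "An efficient program checker `C_π` exists for decision
problem `π` ⟺ `π` lies in function-restricted IP ∩ co-function-restricted IP."** In the tree's
rendering (module docstring): `Q` is checkable iff both `Q` and `Q.swap` have polynomial-time
function-restricted proof systems — for a language, "`L` has an instance checker if(f) both `L`
and `L̄` have function-restricted interactive proof systems" (FRS94 p. 550;
`instanceCheckable_iff.language`). (⇐: ask the program for its answer at `x` and run the proof
system of the claimed side with the program, resp. its negation, as oracle; ⇒: accept a
YES-claim of the oracle iff the checker, run with that oracle as the program, says CORRECT.)
A named fact: the two oracle-machine compositions are not carried out here.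
[cite: BlumKannan1995, Thm. 7.1 (p. 288)] [cite: FortnowRompelSipser1994, §3 (p. 550)] -/
def instanceCheckable_iff : Prop :=
  ∀ Q : PromiseProblem, Q.InstanceCheckable ↔ Q ∈ PromiseFrIP ∧ Q.swap ∈ PromiseFrIP

/-! ### API -/

/-- Unfolding lemma for `PromiseFrIP`. [cite: BlumKannan1995, §7 (p. 288)] -/
theorem mem_PromiseFrIP_iff {Q : PromiseProblem} :
    Q ∈ PromiseFrIP ↔ ∃ M : ProbOracleMachine, M.IsPPT encodingBoolBool ∧ FrProves M Q :=
  Iff.rfl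

/-- Unfolding lemma for `frIP`: FRS94's two clauses, the honest oracle being `L` itself.
[cite: FortnowRompelSipser1994, §3 (p. 550)] -/
theorem mem_frIP_iff {L : Language Bool} :
    L ∈ frIP ↔ ∃ M : ProbOracleMachine, M.IsPPT encodingBoolBool ∧
      (∀ x ∈ L, (2 / 3 : ℝ) ≤ M.acceptProbOn (Oracle.ofLanguage L) x) ∧
        ∀ (A : Language Bool), ∀ x ∉ L, M.acceptProbOn (Oracle.ofLanguage A) x ≤ 1 / 3 := by
  refine exists_congr fun M => and_congr Iff.rfl ?_
  simp only [FrProves, PromiseProblem.isDecidedBy_ofLanguage_iff, forall_eq,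
    PromiseProblem.yes_ofLanguage, PromiseProblem.no_ofLanguage]
  rfl

/-- Unfolding lemma for `InstanceCheckable L`: AB Def. 8.26 for `T = χ_L` — (1) with the correct
program `L` as oracle the checker says CORRECT on every `x` with probability `≥ 2/3`, (2) if the
program `A` is wrong at `x` it says CORRECT with probability `≤ 1/3`.
[cite: AroraBarakCC2009, Def. 8.26] -/
theorem instanceCheckable_iff_language {L : Language Bool} :
    InstanceCheckable L ↔ ∃ C : ProbOracleMachine, C.IsPPT encodingBoolBool ∧
      (∀ x, (2 / 3 : ℝ) ≤ C.acceptProbOn (Oracle.ofLanguage L) x) ∧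
        ∀ (A : Language Bool) (x : List Bool), ¬ (x ∈ A ↔ x ∈ L) →
          C.acceptProbOn (Oracle.ofLanguage A) x ≤ 1 / 3 := by
  refine exists_congr fun C => and_congr Iff.rfl ?_
  constructor
  · intro h
    refine ⟨fun x => (h L x).1 (PromiseProblem.isDecidedBy_ofLanguage_iff.2 rfl) ?_, fun A x hx =>
      (h A x).2 (PromiseProblem.errsAt_ofLanguage_iff.2 hx)⟩
    simp only [PromiseProblem.yes_ofLanguage, PromiseProblem.no_ofLanguage]
    exact em _
  · rintro ⟨h₁, h₂⟩ A x
    refine ⟨fun hA _ => ?_, fun hx => h₂ A x (PromiseProblem.errsAt_ofLanguage_iff.1 hx)⟩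
    rw [PromiseProblem.isDecidedBy_ofLanguage_iff.1 hA]
    exact h₁ x

/-- **Blum–Kannan's criterion for languages** (from the named fact): `L` has an instance checker
iff both `L` and `Lᶜ` are in `frIP` — FRS94 p. 550. [cite: FortnowRompelSipser1994, §3 (p. 550)]
[cite: BlumKannan1995, Thm. 7.1] -/
theorem instanceCheckable_iff.language (h : instanceCheckable_iff) (L : Language Bool) :
    InstanceCheckable L ↔ L ∈ frIP ∧ Lᶜ ∈ frIP := by
  have h' := h (PromiseProblem.ofLanguage L)
  rw [PromiseProblem.swap_ofLanguage] at h'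
  exact h'

/-- The two clauses of a function-restricted proof system never conflict: on a NO-instance no
oracle reaches acceptance probability `2/3`. [folklore] -/
theorem FrProves.not_le_of_mem_no {M : ProbOracleMachine} {Q : PromiseProblem} (h : FrProves M Q)
    {x : List Bool} (hx : x ∈ Q.no) (A : Language Bool) :
    ¬ (2 / 3 : ℝ) ≤ M.acceptProbOn (Oracle.ofLanguage A) x := by
  have h' := h.2 A x hx
  intro h2
  linarith

/-- With a bug-free program as oracle, a checker says CORRECT on every instance with probability
`≥ 2/3`; in particular it cannot also report a bug there (the two clauses never conflict).
[cite: BlumKannan1995, §2 (p. 271)] -/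
theorem IsInstanceChecker.le_of_isDecidedBy {C : ProbOracleMachine} {Q : PromiseProblem}
    (h : IsInstanceChecker C Q) {A : Language Bool} (hA : Q.IsDecidedBy A) {x : List Bool}
    (hx : x ∈ Q.yes ∨ x ∈ Q.no) : (2 / 3 : ℝ) ≤ C.acceptProbOn (Oracle.ofLanguage A) x :=
  (h A x).1 hA hx

/-! ### Non-vacuity: `P ⊆ frIP` -/

/-- The acceptance probability of a QUERY-FREE machine `⟨OracleAlg.ofFun g, c, 1⟩` is the fraction
of coin strings `r` with `g ⟨x, r⟩ = true`, whatever the oracle. [folklore] -/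
theorem acceptProbOn_ofFun (g : List Bool → Bool) (c : Polynomial ℕ) (O : Oracle) (x : List Bool) :
    (⟨OracleAlg.ofFun g, c, 1⟩ : ProbOracleMachine).acceptProbOn O x =
      uniformProb (c.eval x.length) {r | g (boolPair x r) = true} := by
  rw [OracleAdversary.acceptProbOn_eq]
  simp only [Polynomial.eval_one]
  have hrun : ∀ r : List Bool,
      (OracleAlg.ofFun g).run O 1 (boolPair x r) = some (g (boolPair x r)) := fun r => rfl
  simp only [hrun, Option.some.injEq]

/-- **`P ⊆ frIP`** (non-vacuity of the definitions; the bottom of FRS94's picture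
`P ⊆ frIP ⊆ MIP`): for `L ∈ P` the verifier ignores its oracle and its coins and decides `x`
itself — the query-free machine `OracleAlg.ofFun χ_{L'}` with `L' = {w | (boolUnpair w).1 ∈ L} ∈ P`
(`preimage_mem_P`, `boolUnpairFst_mem_FP`), polynomial-time by `OracleAlg.isPolyTime_ofFun_holds`;
it accepts members with probability `1` and non-members with probability `0` against every oracle.
[cite: FortnowRompelSipser1994, §3 (p. 548)] [cite: BakerGillSolovay1975, §1 (P ⊆ P^X)] -/
theorem P_subset_frIP : Classes.P ⊆ frIP := by
  intro L hL
  have hL' : ((fun w => (boolUnpair w).1) ⁻¹' L : Language Bool) ∈ Classes.P :=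
    preimage_mem_P hL boolUnpairFst_mem_FP
  set L' : Language Bool := (fun w => (boolUnpair w).1) ⁻¹' L with hL'def
  have hmem : ∀ x r : List Bool, boolPair x r ∈ L' ↔ x ∈ L := fun x r => by
    change (boolUnpair (boolPair x r)).1 ∈ L ↔ x ∈ L
    rw [boolUnpair_boolPair]
  refine ⟨⟨OracleAlg.ofFun L'.boolIndicator, 0, 1⟩,
    OracleAlg.isPolyTime_ofFun_holds (polyTimeDecidable_iff.1 (mem_P_iff_holds.1 hL')), ?_, ?_⟩
  · intro A _ x hx
    rw [PromiseProblem.yes_ofLanguage] at hx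
    rw [acceptProbOn_ofFun]
    have hset : {r : List Bool | L'.boolIndicator (boolPair x r) = true} = Set.univ :=
      Set.eq_univ_of_forall fun r => (Set.mem_iff_boolIndicator _ _).1 ((hmem x r).2 hx)
    rw [hset, uniformProb_univ]
    norm_num
  · intro A x hx
    rw [PromiseProblem.no_ofLanguage] at hx
    rw [acceptProbOn_ofFun]
    have hset : {r : List Bool | L'.boolIndicator (boolPair x r) = true} = ∅ :=
      Set.eq_empty_of_forall_notMem fun r hr =>
        hx ((hmem x r).1 ((Set.mem_iff_boolIndicator _ _).2 hr))
    rw [hset, uniformProb_empty]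
    norm_num

end Literature.Computability.Complexity
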